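import Summits.BirchSwinnertonDyer.Rank1Residual.X11b.SemistableRecordsReduction
import Summits.BirchSwinnertonDyer.Rank1Residual.X11b.MultiplicativeDivisibilityRam
import Summits.BirchSwinnertonDyer.BirchSwinnertonDyer.Theorems.Rank1ResidualX11RankOneFinal
import HarnessLib

/-!
# BSD rank-≤1 residual cell, class X11b ∧ r = 1 ∧ p ≥ 5: `BSD(E,p)` for the 58 SEMISTABLE in-window
# pairs from FOUR published facts + modularity and THREE numbers per pair; with the 85 non-semistable
# records, ALL 143 in-window pairs of the row (141 counted + 2 member obligations, N < 2·10⁴)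

HONEST FRAMING (cell `b2b-bsdres-*`, verbatim): prove what is provable now; shrink each hard class
to its core with data; no claim beyond stated classes; COMBINATION classes deleted from PUBLISHED
theorems only, CONSTRUCTION-shaped remainder typed; this is not "finishing BSD". Class X11b stays
CONSTRUCTION-SHAPED; everything here is PER PAIR; no lane verdict is changed; no named fact.

Unit `b2b-bsdres-x11c`, gen 9. Theorems only. The per-pair consumer of record for a class-X11b pair with
a (ram) prime is `X11b.ClassX11b.bsdp_of_ram_{split,nonsplit}_of_certificate` (gen 5, p206079:
Skinner 2016 Thm. A (A31) ∘ the typed divisibility `MultDivisibilityAt` ∘ Stein–Wuthrich 2013 Thm. 6.1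
(A37) + §4.2 height existence (A38) + GZK (A18) + the two-number certificate + `p ∤ #Ш_an`). Here it is
instantiated for every record `r ∈ sstRecords1 ++ sstRecords2` with ALL bookkeeping discharged in the
kernel: `p` prime, `Δ ≠ 0`, global minimality of Cremona's model, `Mult`, split type, `Ram`, `Irr`
(`SemistableRecordsReduction.lean`), the cyclotomic / Selmer-dual / Tate-parameter / newform / period
data (tree theorems + modularity `hpar`), the MTT `p`-adic `L`-function (split: tree theorem
`exists_isSplitMultPAdicLFunctionOf`; non-split: tree theorem `exists_isMultPAdicLFunctionOf_neg_one_holds`).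

* `bsdp_sst_of_split_of_mem` / `bsdp_sst_of_nonsplit_of_mem` — per record, CORE hypotheses only;
* **`bsdp_of_published_of_threeNumbers_sst`** — the headline for the 58: Skinner 2016 Thm. A `hA`,
  Stein–Wuthrich 2013 Thm. 6.1 split/non-split `hJs`/`hJn`, SW §4.2 height existence `hHs`/`hHn`, GZK
  `hGZK`, modularity `hpar` (all PUBLISHED named facts) and, per record, ONLY the three engine numbers —
  analytic rank `= 1`, `#Ш_an` as recorded (`= 1`), and the two-engine `p`-adic valuation identity
  (`CertSplit` / `CertNonsplit`) — give Miller's `BSD(E,p)`;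
* **`bsdp_of_published_of_threeNumbers_window`** — the 85 ¬sst records (`X11RankOne.bsdp_of_published_of_threeNumbers`,
  x11c gen 2: ten published facts incl. Kato–Wuthrich surjective divisibility `hK` for the 11 (ram)-free
  pairs and Wuthrich Prop. 21 `hW`) and the 58 sst records TOGETHER: every one of the 143 in-window pairs
  of row X11b at `p ≥ 5` (hyp `X11B-P5-BINDERS.md`: 141 counted ‖ 38 below 10⁴, + 2 member obligations).

Nothing here is a class theorem; the lane books per pair (referee A), the label is unchanged.

References: C. Skinner, Pacific J. Math. 283 (2016) Thm. A [Skinner2016PacificMC]; W. Stein, C. Wuthrich,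
Math. Comp. 82 (2013) Thm. 6.1, §4.2 [SteinWuthrich2013]; C. Wuthrich, Doc. Math. 19 (2014)
[Wuthrich2014]; Mazur–Tate–Teitelbaum 1986 [MazurTateTeitelbaum1986Invent]; R. L. Miller, LMS J. Comput.
Math. 14 (2011) Prop. 7.6 [Miller2011LMS]; Cremona's tables [Cremona2006].
-/

set_option autoImplicit false

noncomputable section

open scoped Classical MatrixGroups ModularForm

open CongruenceSubgroup WeierstrassCurve Literature.NumberTheory.EllipticCurves
  Literature.NumberTheory.EllipticCurves.ModularForms
  Literature.NumberTheory.EllipticCurves.Rank1Residual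
  Literature.NumberTheory.EllipticCurves.Rank1Residual.Typed
  Literature.NumberTheory.EllipticCurves.Skinner2016
  Literature.NumberTheory.EllipticCurves.Wuthrich2014
  Literature.NumberTheory.EllipticCurves.SteinWuthrich2013
  Literature.NumberTheory.EllipticCurves.Rank1Residual.X11RankOneCertificates
  Summit.BirchSwinnertonDyer.BirchSwinnertonDyer.Rank1Residual

namespace Summit.BirchSwinnertonDyer.Rank1Residual.X11b

section Consumers

variable (r : Record) [Fact r.p.Prime] [r.curve.IsElliptic] [r.curve.IsGloballyMinimal]

/-- **Semistable record, SPLIT multiplicative `p ≥ 5`, CORE hypotheses only**: Skinner 2016 Thm. A `hA`,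
Stein–Wuthrich Thm. 6.1 `hJ`, SW §4.2 height existence `hH`, GZK, modularity `hpar`, plus analytic rank
`1`, `#Ш_an` as recorded and the `p`-adic certificate `CertSplit` ⟹ `BSD(E,p)` — through the consumer of
record `ClassX11b.bsdp_of_ram_split_of_certificate`; `Mult`, `Irr`, `Ram`, the split type are the kernel
theorems of `reduction_of_mem_sst`. [cite: Skinner2016PacificMC, Thm. A (§1), §3.2]
[cite: SteinWuthrich2013, Thm. 6.1 (p. 20) and §4.2] -/
theorem bsdp_sst_of_split_of_mem (hr : r ∈ sstRecords1 ++ sstRecords2)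
    (hA : thmA_charIdeal_multiplicative) (hJ : thm61_splitMultiplicative)
    (hH : exists_isSplitMultCanonical) (hGZK : rank_eq_analyticRank_of_analyticRank_le_one)
    (hpar : nonempty_modularParametrizationData)
    (hsplit : r.split = true) (hran : r.curve.analyticRank = 1)
    (hsha : Literature.NumberTheory.EllipticCurves.shaAn r.curve = ((r.shaAn : ℚ) : ℂ))
    (hcs : r.CertSplit) : BSDp r.curve r.p := by
  obtain ⟨hmult, hsp, -, hram, hirr⟩ := reduction_of_mem_sst r hr
  have hp5 : 5 ≤ r.p := five_le_of_mem_sst r hr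
  have hX : ClassX11b r.curve r.p := ⟨hran, by omega, hmult, hirr⟩
  have hsplit' := hsp hsplit
  obtain ⟨κ, hκ, γ, hγ, hγ'⟩ := exists_isCyclotomic_isTopGenerator_isCyclotomicVariable_holds r.p
  obtain ⟨D⟩ := r.curve.nonempty_selmerDualData_holds κ γ hγ
  haveI : NeZero (r.curve.conductorNorm ℤ) := ⟨(r.curve.conductorNorm_pos_holds).ne'⟩
  obtain ⟨Dm⟩ := hpar r.curve
  obtain ⟨ϖ, hϖpos, hϖ, -⟩ := Dm.exists_rat_mul_realPeriodRat_eq_plusPeriod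
  obtain ⟨L, hL⟩ := exists_isSplitMultPAdicLFunctionOf hsplit' Dm.isNewformOf
  obtain ⟨Dq⟩ := (nonempty_tateParameterData_iff_holds (W := r.curve) (p := r.p)).mpr hsplit'
  have hrank : r.curve.mordellWeilRank = 1 := by rw [(hGZK r.curve (le_of_eq hran)).1, hran]
  obtain ⟨hordL, hcert⟩ := hcs Dm.f ϖ L Dm.isNewformOf hϖ hL
  exact X11b.ClassX11b.bsdp_of_ram_split_of_certificate hA hJ hH hGZK r.curve r.p (by omega) hX hram Dq
    hκ hγ hγ' Dm.isNewformOf D ϖ hϖpos.ne' hϖ L hL (by rw [hrank]; exact hordL)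
    (fun Dh hDh => by rw [hrank]; exact hcert Dq Dh hDh) hsha (padicValRat_shaAn_eq_zero_of_mem_sst r hr)

/-- **Semistable record, NON-SPLIT multiplicative `p ≥ 5`, CORE hypotheses only** (the `p`-adic
`L`-function at the non-split prime from the tree theorem `exists_isMultPAdicLFunctionOf_neg_one_holds`,
MTT 1986; the Tate parameter from `existsUnique_tateJ_eq_of_one_lt_norm`).
[cite: Skinner2016PacificMC, Thm. A (§1), §3.2] [cite: SteinWuthrich2013, Thm. 6.1 (p. 20), §3.1 (p. 9), §4.2]
[cite: MazurTateTeitelbaum1986Invent, §I.10–I.14] -/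
theorem bsdp_sst_of_nonsplit_of_mem (hr : r ∈ sstRecords1 ++ sstRecords2)
    (hA : thmA_charIdeal_multiplicative) (hJ : thm61_nonsplitMultiplicative)
    (hH : exists_isMultCanonical) (hGZK : rank_eq_analyticRank_of_analyticRank_le_one)
    (hpar : nonempty_modularParametrizationData)
    (hsplit : r.split = false) (hran : r.curve.analyticRank = 1)
    (hsha : Literature.NumberTheory.EllipticCurves.shaAn r.curve = ((r.shaAn : ℚ) : ℂ))
    (hcn : r.CertNonsplit) : BSDp r.curve r.p := by
  obtain ⟨hmult, -, hnsp, hram, hirr⟩ := reduction_of_mem_sst r hr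
  have hp5 : 5 ≤ r.p := five_le_of_mem_sst r hr
  have hX : ClassX11b r.curve r.p := ⟨hran, by omega, hmult, hirr⟩
  have hns := hnsp hsplit
  obtain ⟨κ, hκ, γ, hγ, hγ'⟩ := exists_isCyclotomic_isTopGenerator_isCyclotomicVariable_holds r.p
  obtain ⟨D⟩ := r.curve.nonempty_selmerDualData_holds κ γ hγ
  haveI : NeZero (r.curve.conductorNorm ℤ) := ⟨(r.curve.conductorNorm_pos_holds).ne'⟩
  obtain ⟨Dm⟩ := hpar r.curve
  obtain ⟨ϖ, hϖpos, hϖ, -⟩ := Dm.exists_rat_mul_realPeriodRat_eq_plusPeriod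
  obtain ⟨L, hL⟩ := exists_isMultPAdicLFunctionOf_neg_one_holds r.curve r.p Dm.f hmult hns Dm.isNewformOf
  obtain ⟨q, ⟨hq0, hq1, hqj⟩, -⟩ := existsUnique_tateJ_eq_of_one_lt_norm
    (one_lt_norm_j_of_hasMultiplicativeReductionAtPrime (W := r.curve) (p := r.p) hmult)
  have hrank : r.curve.mordellWeilRank = 1 := by rw [(hGZK r.curve (le_of_eq hran)).1, hran]
  obtain ⟨hordL, hcert⟩ := hcn Dm.f ϖ L Dm.isNewformOf hϖ hL
  exact X11b.ClassX11b.bsdp_of_ram_nonsplit_of_certificate hA hJ hH hGZK r.curve r.p (by omega) hX hram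
    hns hq0 hq1 hqj hκ hγ hγ' Dm.isNewformOf D ϖ hϖpos.ne' hϖ L hL (by rw [hrank]; exact hordL)
    (fun Dh hDh => by rw [hrank, pow_one]; simpa using hcert q hq0 hq1 hqj Dh hDh) hsha
    (padicValRat_shaAn_eq_zero_of_mem_sst r hr)

end Consumers

/-- **HEADLINE — `BSD(E,p)` for all 58 SEMISTABLE in-window pairs of X11b ∧ r = 1 ∧ p ≥ 5 (the 56
counted former `T-CAS` pairs + the 2 member obligations, `N < 2·10⁴`) from FOUR published named facts +
modularity and THREE NUMBERS per pair.** Hypotheses: Skinner 2016 Thm. A `hA`, Stein–Wuthrich 2013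
Thm. 6.1 `hJs`/`hJn`, SW §4.2 height existence `hHs`/`hHn`, Gross–Zagier–Kolyvagin `hGZK`, modularity
`hpar`; and per record: analytic rank `= 1`, `#Ш_an` as recorded (`= 1`), the `p`-adic certificate
(`CertSplit` / `CertNonsplit`: `ord_T L_p = r + e` and the valuation identity — PARI + msengine, two
runs each for the 56, this unit's gen-9 jobs for the 2). Primality, non-singularity, global minimality,
`Mult`, split type, (ram) and `Irr` are kernel theorems. Per pair; class label unchanged.
[cite: Skinner2016PacificMC, Thm. A] [cite: SteinWuthrich2013, Thm. 6.1 (p. 20) and §4.2]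
[cite: MazurTateTeitelbaum1986Invent, §I.10–I.14 and §II.10] [cite: Mazur1978, §6 Prop. 6.3 (1) (p. 153)] -/
theorem bsdp_of_published_of_threeNumbers_sst
    (hA : thmA_charIdeal_multiplicative)
    (hJs : thm61_splitMultiplicative) (hJn : thm61_nonsplitMultiplicative)
    (hHs : exists_isSplitMultCanonical) (hHn : exists_isMultCanonical)
    (hGZK : rank_eq_analyticRank_of_analyticRank_le_one) (hpar : nonempty_modularParametrizationData)
    (hnum : ∀ r ∈ sstRecords1 ++ sstRecords2,
      ∀ [Fact r.p.Prime] [r.curve.IsElliptic] [r.curve.IsGloballyMinimal],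
        r.curve.analyticRank = 1 ∧
        Literature.NumberTheory.EllipticCurves.shaAn r.curve = ((r.shaAn : ℚ) : ℂ) ∧
        (r.split = true → r.CertSplit) ∧ (r.split = false → r.CertNonsplit))
    (r : Record) (hr : r ∈ sstRecords1 ++ sstRecords2) : BSDp r.curve r.p := by
  haveI : Fact r.p.Prime := ⟨prime_of_mem_sst r hr⟩
  haveI : r.curve.IsElliptic := isElliptic_curve_of_mem_sst r hr
  haveI : r.curve.IsGloballyMinimal := isGloballyMinimal_curve_of_mem_sst r hr
  obtain ⟨hran, hsha, hcs, hcn⟩ := hnum r hr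
  cases hs : r.split
  · exact bsdp_sst_of_nonsplit_of_mem r hr hA hJn hHn hGZK hpar hs hran hsha (hcn hs)
  · exact bsdp_sst_of_split_of_mem r hr hA hJs hHs hGZK hpar hs hran hsha (hcs hs)

/-- **THE WINDOW — `BSD(E,p)` for ALL 143 in-window pairs of row X11b at `p ≥ 5`** (`N < 2·10⁴`: the 85
non-semistable records `records1 ++ records2` of x11c gen 0–2 and the 58 semistable records of gen 9;
= hyp's 141 counted pairs ‖ 38 below 10⁴ + the 2 member obligations) from the ELEVEN published named
facts of `X11RankOne.bsdp_of_published_of_threeNumbers` (Kato–Wuthrich surjective divisibility `hK` —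
used only for the 11 (ram)-free non-semistable pairs —, Skinner 2016 Thm. A `hA`, Stein–Wuthrich 2013
Thm. 6.1 ×2, SW §4.2 ×2, Wuthrich 2014 Prop. 21 `hW`, GZK, modularity ×2) and THREE NUMBERS per pair.
Per pair; nothing booked here; the class label is unchanged.
[cite: Skinner2016PacificMC, Thm. A] [cite: SteinWuthrich2013, Thm. 6.1 (p. 20) and §4.2]
[cite: Wuthrich2014, Thm. 3 (p. 383), Cor. 19 (p. 398), Prop. 21 (p. 400)] [cite: Serre1972, §2.8 Prop. 19] -/
theorem bsdp_of_published_of_threeNumbers_window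
    (hK : kato_charIdeal_dvd_multiplicative_of_surjective) (hA : thmA_charIdeal_multiplicative)
    (hJs : thm61_splitMultiplicative) (hJn : thm61_nonsplitMultiplicative)
    (hHs : exists_isSplitMultCanonical) (hHn : exists_isMultCanonical)
    (hW : Wuthrich2014.sha_dvd_analyticSha) (hGZK : rank_eq_analyticRank_of_analyticRank_le_one)
    (hmod : hasEntireLFunction_rat) (hpar : nonempty_modularParametrizationData)
    (hnum : ∀ r ∈ (records1 ++ records2) ++ (sstRecords1 ++ sstRecords2),
      ∀ [Fact r.p.Prime] [r.curve.IsElliptic] [r.curve.IsGloballyMinimal],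
        r.curve.analyticRank = 1 ∧
        Literature.NumberTheory.EllipticCurves.shaAn r.curve = ((r.shaAn : ℚ) : ℂ) ∧
        (r.split = true → r.CertSplit) ∧ (r.split = false → r.CertNonsplit))
    (r : Record) (hr : r ∈ (records1 ++ records2) ++ (sstRecords1 ++ sstRecords2)) : BSDp r.curve r.p := by
  rcases List.mem_append.mp hr with h85 | h58
  · exact X11RankOne.bsdp_of_published_of_threeNumbers hK hA hJs hJn hHs hHn hW hGZK hmod hpar
      (fun r' hr' ↦ hnum r' (List.mem_append.mpr (Or.inl hr'))) r h85
  · exact bsdp_of_published_of_threeNumbers_sst hA hJs hJn hHs hHn hGZK hpar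
      (fun r' hr' ↦ hnum r' (List.mem_append.mpr (Or.inr hr'))) r h58

/-- The window list has `85 + 58 = 143` records. [folklore] -/
theorem length_window : ((records1 ++ records2) ++ (sstRecords1 ++ sstRecords2)).length = 143 := by
  rw [List.length_append, X11RankOne.length_records, length_sstRecords.1]

end Summit.BirchSwinnertonDyer.Rank1Residual.X11b

end
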